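import Summits.Ventures.PercRepro.SixFourResidueS0CountB
import Summits.Ventures.PercRepro.SixFourPLProfileB
import Summits.Ventures.PercRepro.SixFourPLPlanes
import Summits.Ventures.PercRepro.SixFourPLCovPairs3

/-!
# PercRepro — C-025 at `(6,4)`: the structure `S₀` of §21.18.9.3 — `X ≤ 50` for a plane-line solid with profile `π₀`
(p2, gen 8; the matroid half — the counting half is `SixFourResidueS0Count.lean` + `SixFourResidueS0CountB.lean`)

A plane-line solid `G` on `8` points with coarse profile `π₀ = (meet, p = 5, n = 3, inc = (4, 0, 1, 0, 0, 0),
sizes = (2, 2, 2, 2))` has the meeting point `z = ℓ ∩ ρ`, classes `λ_y = {y, z}` (`y ∈ ρ ∖ {z}`), a unique `4`-line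
`μ = ρ ∖ {z}` of `ρ` (the only non-class line trace), and — by `plane_trichotomy` — every rank-`3` plane trace is one
of the eight `5`-sets `ρ`, `L ∪ {z, y}` (`y ∈ μ`), `{x} ∪ μ` (`x ∈ L`) (`trace_listed_of_pi0`).  Every `Z` counted by
`X` lies in such a trace and so does `G ∖ Z` (`exists_plane_superset3`), so `X ≤ 50` by the count of
`SixFourResidueS0Count.lean` (`Xcnt_le_fifty_of_pi0`).  Imports LANDED modules only.
-/

/-! ## The matroid half: a plane-line solid with profile `π₀` -/

namespace PercRepro.SixFour

open Finset ThmH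

variable {α : Type*} [DecidableEq α] {M : Matroid α} [M.Finite] {G : Finset α}

namespace PLData

variable {D : PLData M G}

/-- `ρ ∪ L = G`. -/
theorem ρ_union_L_eq : D.ρ ∪ D.L = G := by
  ext v
  unfold ρ L
  rw [Finset.mem_union, Finset.mem_inter, Finset.mem_sdiff]
  constructor
  · rintro (⟨-, h⟩ | ⟨h, -⟩) <;> exact h
  · intro h
    by_cases hv : v ∈ D.P₀
    · exact Or.inl ⟨hv, h⟩
    · exact Or.inr ⟨h, hv⟩

/-- `L ∩ ρ = ∅`. -/
theorem notMem_ρ_of_mem_L_S0 {v : α} (hv : v ∈ D.L) : v ∉ D.ρ := by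
  unfold L at hv
  unfold ρ
  rw [Finset.mem_sdiff] at hv
  rw [Finset.mem_inter]
  exact fun h => hv.2 h.1

/-- `|sizes| = #classes`. -/
theorem sizes_length : D.sizes.length = D.classes.card := by
  unfold sizes
  rw [List.length_reverse, Multiset.length_sort, Multiset.card_map, Finset.card_val]

omit [DecidableEq α] [M.Finite] in
/-- A rank-`2` set has at least `2` points. -/
theorem two_le_card_of_eRk_eq_two' {X : Finset α} (hr : M.eRk (X : Set α) = 2) : 2 ≤ X.card := by
  have h := M.eRk_le_encard (X : Set α)
  rw [hr, Set.encard_coe_eq_coe_finsetCard] at h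
  exact_mod_cast h

/-- The data of `π₀` read off the profile. -/
theorem pi0_data (hπ : D.profile = ⟨true, 5, 3, [4, 0, 1, 0, 0, 0], [2, 2, 2, 2]⟩) :
    (D.ellF ∩ D.ρ).card = 1 ∧ D.ρ.card = 5 ∧ D.L.card = 3 ∧ inc M D.ρ 2 = 4 ∧ inc M D.ρ 3 = 0 ∧
      inc M D.ρ 4 = 1 ∧ inc M D.ρ 5 = 0 ∧ D.sizes = [2, 2, 2, 2] := by
  have hmeet : D.meet = true := by
    have : D.profile.meet = true := by rw [hπ]
    exact this
  have h1 : (D.ellF ∩ D.ρ).card = 1 := by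
    unfold meet at hmeet
    exact of_decide_eq_true hmeet
  have hp : D.ρ.card = 5 := by
    have : D.profile.p = 5 := by rw [hπ]
    exact this
  have hn : D.L.card = 3 := by
    have : D.profile.n = 3 := by rw [hπ]
    exact this
  have hsz : D.sizes = [2, 2, 2, 2] := by
    have : D.profile.sizes = [2, 2, 2, 2] := by rw [hπ]
    exact this
  have hi : ∀ i, i < 6 → inc M D.ρ (i + 2) = ([4, 0, 1, 0, 0, 0] : List ℕ).getD i 0 := by
    intro i hi
    rw [← inc_profile (D := D) i hi, hπ]
  have h2 := hi 0 (by norm_num)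
  have h3 := hi 1 (by norm_num)
  have h4 := hi 2 (by norm_num)
  have h5 := hi 3 (by norm_num)
  simp only [List.getD_cons_zero, List.getD_cons_succ, zero_add, Nat.reduceAdd] at h2 h3 h4 h5
  exact ⟨h1, hp, hn, h2, h3, h4, h5, hsz⟩

/-- **The structure `S₀`**: with profile `π₀`, the meeting point `z`, every class is `{y, z}`, the unique `4`-line of
`ρ` is `ρ ∖ {z}`, and every rank-`3` plane trace is `ρ`, `L ∪ {z, y}` (`y ∈ ρ ∖ {z}`) or `{x} ∪ (ρ ∖ {z})`
(`x ∈ L`). -/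
theorem trace_listed_of_pi0 (hs : Simple M) (hG : G ⊆ gr M)
    (hπ : D.profile = ⟨true, 5, 3, [4, 0, 1, 0, 0, 0], [2, 2, 2, 2]⟩) :
    ∃ z ∈ D.ρ, ∀ P ∈ planes M, M.eRk ((P ∩ G : Finset α) : Set α) = 3 →
      S0.Listed D.ρ D.L z (P ∩ G) := by
  obtain ⟨h1, hp, hn, hi2, hi3, hi4, hi5, hsz⟩ := pi0_data hπ
  have h2 : 2 ≤ D.L.card := by omega
  obtain ⟨z, hz⟩ := Finset.card_eq_one.1 h1
  have hzℓ : z ∈ D.ellF := (Finset.mem_inter.1 (hz ▸ Finset.mem_singleton_self z)).1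
  have hzρ : z ∈ D.ρ := (Finset.mem_inter.1 (hz ▸ Finset.mem_singleton_self z)).2
  have hρg : D.ρ ⊆ gr M := D.ρ_subset.trans hG
  -- a point of `ρ` other than `z` is off `ℓ`
  have hoff : ∀ y ∈ D.ρ, y ≠ z → y ∉ D.ellF := fun y hy hyz hyℓ =>
    hyz (Finset.mem_singleton.1 (hz ▸ Finset.mem_inter.2 ⟨hyℓ, hy⟩))
  -- every class is `{y, z}`
  have hclass : ∀ y ∈ D.ρ, y ≠ z → D.lam y = {y, z} := by
    intro y hy hyz
    have hyℓ := hoff y hy hyz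
    have hcard : (D.lam y).card = 2 := by
      have hmem : (D.lam y).card ∈ D.sizes := mem_sizes.2 ⟨y, Finset.mem_sdiff.2 ⟨hy, hyℓ⟩, rfl⟩
      rw [hsz] at hmem
      simp only [List.mem_cons, List.not_mem_nil, or_false, or_self] at hmem
      exact hmem
    have hsub : ({y, z} : Finset α) ⊆ D.lam y := by
      intro v hv
      rw [Finset.mem_insert, Finset.mem_singleton] at hv
      rcases hv with rfl | rfl
      · exact mem_lam_self hs hG h2 hy hyℓ
      · exact mem_lam_of_mem_ellF hzℓ hzρ
    symm
    apply Finset.eq_of_subset_of_card_le hsub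
    rw [hcard, Finset.card_pair hyz]
  -- the unique `4`-line of `ρ`
  have hfilt4 : ((lines M).filter fun Λ : Finset α => (Λ ∩ D.ρ).card = 4).card = 1 := hi4
  obtain ⟨Λ₄, hΛ₄⟩ := Finset.card_eq_one.1 hfilt4
  have hΛ₄mem : Λ₄ ∈ lines M ∧ (Λ₄ ∩ D.ρ).card = 4 :=
    Finset.mem_filter.1 (hΛ₄ ▸ Finset.mem_singleton_self Λ₄)
  have huniq4 : ∀ Λ ∈ lines M, (Λ ∩ D.ρ).card = 4 → Λ = Λ₄ := fun Λ hΛ hc =>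
    Finset.mem_singleton.1 (hΛ₄ ▸ Finset.mem_filter.2 ⟨hΛ, hc⟩)
  -- `z ∉ Λ₄`
  have hzΛ : z ∉ Λ₄ := by
    intro hzΛ
    obtain ⟨y, hy, hyz⟩ := Finset.exists_mem_ne (by omega : 1 < (Λ₄ ∩ D.ρ).card) z
    rw [Finset.mem_inter] at hy
    have hyℓ := hoff y hy.2 hyz
    have hyG := D.ρ_subset hy.2
    have hPi := Pi_mem_planes hs hG h2 hyG hyℓ
    -- `Λ₄ = cl{y, z} ⊆ Π_y`
    have hpair : (({y, z} : Finset α) : Set α) ⊆ (Λ₄ : Set α) := by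
      intro v hv
      rw [Finset.mem_coe, Finset.mem_insert, Finset.mem_singleton] at hv
      rcases hv with rfl | rfl
      · exact hy.1
      · exact hzΛ
    have hr2 : M.eRk (({y, z} : Finset α) : Set α) = 2 := by
      apply le_antisymm
      · rw [← (mem_lines.1 hΛ₄mem.1).2.2]
        exact M.eRk_mono hpair
      · exact two_le_eRk_of_two_mem hs ((Finset.coe_subset.1 hpair).trans (mem_lines.1 hΛ₄mem.1).1)
          (Finset.mem_insert_self _ _) (Finset.mem_insert_of_mem (Finset.mem_singleton_self _)) hyz
    have hcl := closure_eq_of_subset_line hΛ₄mem.1 (Finset.coe_subset.1 hpair) hr2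
    have hsubPi : (Λ₄ : Set α) ⊆ (D.Pi y : Set α) := by
      rw [← hcl]
      calc M.closure (({y, z} : Finset α) : Set α) ⊆ M.closure (D.Pi y : Set α) := by
            apply M.closure_subset_closure
            intro v hv
            rw [Finset.mem_coe, Finset.mem_insert, Finset.mem_singleton] at hv
            rcases hv with rfl | rfl
            · exact Finset.mem_coe.2 (hPi.2 (Finset.mem_insert_self _ _))
            · exact Finset.mem_coe.2 (ellF_subset_Pi y hzℓ)
        _ = (D.Pi y : Set α) := (mem_planes.1 hPi.1).2.1.closure
    have hsub : Λ₄ ∩ D.ρ ⊆ D.lam y := by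
      intro v hv
      rw [Finset.mem_inter] at hv
      unfold lam
      rw [Finset.mem_inter]
      exact ⟨Finset.mem_coe.1 (hsubPi (Finset.mem_coe.2 hv.1)), hv.2⟩
    have := Finset.card_le_card hsub
    rw [hclass y hy.2 hyz, Finset.card_pair hyz] at this
    omega
  -- `Λ₄ ∩ ρ = ρ ∖ {z}`
  have hμ : Λ₄ ∩ D.ρ = D.ρ.erase z := by
    apply Finset.eq_of_subset_of_card_le
    · intro v hv
      rw [Finset.mem_inter] at hv
      rw [Finset.mem_erase]
      exact ⟨fun h => hzΛ (h ▸ hv.1), hv.2⟩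
    · rw [Finset.card_erase_of_mem hzρ, hp, hΛ₄mem.2]
  -- `#classes = 4`, and every line with a `2`-point trace is a class line
  have hcls4 : D.classes.card = 4 := by
    rw [← sizes_length, hsz]
    rfl
  have hclass_card : ∀ C ∈ D.classes, C.card = 2 := by
    intro C hC
    unfold classes at hC
    rw [Finset.mem_image] at hC
    obtain ⟨y, hy, rfl⟩ := hC
    rw [Finset.mem_sdiff] at hy
    have hyz : y ≠ z := fun h => hy.2 (h ▸ hzℓ)
    rw [hclass y hy.1 hyz, Finset.card_pair hyz]
  have htwo : ∀ Λ ∈ lines M, (Λ ∩ D.ρ).card = 2 → Λ ∩ D.ρ ∈ D.classes := by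
    intro Λ hΛ hc
    have himg : D.classes.image (fun C => clF M C) ⊆ (lines M).filter fun Λ' : Finset α => (Λ' ∩ D.ρ).card = 2 := by
      intro Λ' hΛ'
      rw [Finset.mem_image] at hΛ'
      obtain ⟨C, hC, rfl⟩ := hΛ'
      have hcl := class_line hs hG h2 hC (by rw [hclass_card C hC])
      rw [Finset.mem_filter, hcl.2]
      exact ⟨hcl.1, hclass_card C hC⟩
    have hinj : Set.InjOn (fun C => clF M C) (D.classes : Set (Finset α)) := by
      intro C hC C' hC' heq
      have h1 := (class_line hs hG h2 hC (by rw [hclass_card C hC])).2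
      have h2' := (class_line hs hG h2 hC' (by rw [hclass_card C' hC'])).2
      rw [← h1, ← h2']
      simp only at heq
      rw [heq]
    have hcard : ((lines M).filter fun Λ' : Finset α => (Λ' ∩ D.ρ).card = 2).card = 4 := hi2
    have heq : D.classes.image (fun C => clF M C) = (lines M).filter fun Λ' : Finset α => (Λ' ∩ D.ρ).card = 2 := by
      apply Finset.eq_of_subset_of_card_le himg
      rw [hcard, Finset.card_image_of_injOn hinj, hcls4]
    have hΛmem : Λ ∈ D.classes.image (fun C => clF M C) := by
      rw [heq, Finset.mem_filter]
      exact ⟨hΛ, hc⟩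
    rw [Finset.mem_image] at hΛmem
    obtain ⟨C, hC, rfl⟩ := hΛmem
    rw [(class_line hs hG h2 hC (by rw [hclass_card C hC])).2]
    exact hC
  -- the trace list
  refine ⟨z, hzρ, fun P hP h3 => ?_⟩
  rcases plane_trichotomy hs hG h2 hP h3 with rfl | ⟨y, hy, rfl⟩ | ⟨x, hx, htr, hr2, hncl⟩
  · exact Or.inl rfl
  · right; left
    rw [Finset.mem_sdiff] at hy
    have hyz : y ≠ z := fun h => hy.2 (h ▸ hzℓ)
    refine ⟨y, Finset.mem_erase.2 ⟨hyz, hy.1⟩, ?_⟩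
    rw [Pi_inter_eq hs hG h2, ellF_inter_G_eq hs hG h2, hz, hclass y hy.1 hyz]
    ext v
    simp only [Finset.mem_union, Finset.mem_insert, Finset.mem_singleton]
    tauto
  · right; right
    refine ⟨x, hx, ?_⟩
    rw [htr]
    congr 1
    -- `P ∩ ρ` is the trace of the line `cl(P ∩ ρ)`, which has `4` points, hence is `Λ₄`
    have hPρg : P ∩ D.ρ ⊆ gr M := Finset.inter_subset_right.trans hρg
    obtain ⟨hΛ, hsubΛ⟩ := clF_mem_lines hPρg hr2
    have hΛtr : clF M (P ∩ D.ρ) ∩ D.ρ = P ∩ D.ρ := by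
      apply Finset.Subset.antisymm
      · intro v hv
        rw [Finset.mem_inter] at hv ⊢
        refine ⟨?_, hv.2⟩
        have hcl : (clF M (P ∩ D.ρ) : Set α) ⊆ (P : Set α) := by
          rw [coe_clF]
          calc M.closure ((P ∩ D.ρ : Finset α) : Set α) ⊆ M.closure (P : Set α) :=
                M.closure_subset_closure (Finset.coe_subset.2 Finset.inter_subset_left)
            _ = (P : Set α) := (mem_planes.1 hP).2.1.closure
        exact Finset.mem_coe.1 (hcl (Finset.mem_coe.2 hv.1))
      · exact Finset.subset_inter hsubΛ Finset.inter_subset_right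
    have hm2 : 2 ≤ (P ∩ D.ρ).card := two_le_card_of_eRk_eq_two' hr2
    have hm5 : (P ∩ D.ρ).card ≤ 5 := by
      rw [← hp]
      exact Finset.card_le_card Finset.inter_subset_right
    have hinc0 : ∀ m, inc M D.ρ m = 0 → (P ∩ D.ρ).card ≠ m := by
      intro m hm hc
      unfold inc at hm
      rw [Finset.card_eq_zero, Finset.filter_eq_empty_iff] at hm
      exact hm hΛ (by rw [hΛtr]; exact hc)
    have hne2 : (P ∩ D.ρ).card ≠ 2 := by
      intro hc
      apply hncl
      rw [← hΛtr]
      exact htwo _ hΛ (by rw [hΛtr]; exact hc)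
    have hne3 := hinc0 3 hi3
    have hne5 := hinc0 5 hi5
    have hc4 : (P ∩ D.ρ).card = 4 := by omega
    have := huniq4 _ hΛ (by rw [hΛtr]; exact hc4)
    rw [← hΛtr, this, hμ]

/-- **`S₀`, step (4′)**: `X ≤ 50` for a plane-line solid with profile `π₀`. -/
theorem Xcnt_le_fifty_of_pi0 (hs : Simple M) (hG : G ⊆ gr M) (hr : M.eRk (G : Set α) = 4)
    (hπ : D.profile = ⟨true, 5, 3, [4, 0, 1, 0, 0, 0], [2, 2, 2, 2]⟩) : Xcnt M G ≤ 50 := by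
  obtain ⟨-, hp, hn, -, -, -, -, -⟩ := pi0_data hπ
  obtain ⟨z, hzρ, hlist⟩ := trace_listed_of_pi0 hs hG hπ
  rw [Xcnt_eq_card_Xset]
  refine S0.card_le_fifty hp hzρ hn (fun v hv => notMem_ρ_of_mem_L_S0 hv) (Xset M G) (fun Z hZ => ?_)
  obtain ⟨hZG, hZ3, hZ3'⟩ := mem_Xset.1 hZ
  obtain ⟨P₁, hP₁, hZP₁, hr₁⟩ := exists_plane_superset3 hG hr hZG hZ3
  obtain ⟨P₂, hP₂, hZP₂, hr₂⟩ := exists_plane_superset3 hG hr (Finset.sdiff_subset) hZ3'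
  refine ⟨⟨P₁ ∩ G, hlist P₁ hP₁ hr₁, Finset.subset_inter hZP₁ hZG⟩,
    ⟨P₂ ∩ G, hlist P₂ hP₂ hr₂, ?_⟩⟩
  rw [ρ_union_L_eq]
  exact Finset.subset_inter hZP₂ Finset.sdiff_subset

end PLData

end PercRepro.SixFour
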